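import Summits.CriticalPhenomena.SAWScalingLimit.Theorems.SAWLoopFugacityFlowIsingBoundaryRatioWindowRectConnectB
import Summits.CriticalPhenomena.SAWScalingLimit.Theorems.SAWLoopFugacityFlowIsingBoundaryRatioWindowRectCover
import Summits.CriticalPhenomena.SAWScalingLimit.Theorems.SAWLoopFugacityFlowIsingBoundaryRatioWindowRectWhisker
import Summits.CriticalPhenomena.SAWScalingLimit.Theorems.SAWLoopFugacityFlowIsingBoundaryRatioWindowRectCellChain
import Literature.Probability.LatticeModels.DiscreteExtremalLengthExternalArcsProofs
import HarnessLib

/-!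
# Window rectangle: the boundary cycle of `E`, its rim darts and its feet
(line `fk-anchor-transfer`, crux `IsingBoundaryRatio`, stmt-CriticalPhenomena-10650; helper file of the stub
`windowRectPresentation_holds : WindowRectPresentation`)

In the static setting `X : WSetting`: the base dart `X.d₀` (an outer rim dart of `E`), the period `X.N` of its
orbit under `DiscreteRect.succ`, the darts `X.dart i = succ^[i] d₀` and their sites; the orbit covers all
external darts (`…WindowRectCover`); consecutive dart sites have chart points within `κ`. A dart is a **rim**
dart if its missing edge is an edge of `Ω_δ` (its far end is then a vertex of `Ω_δ` off the window, of chart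
radius `< w₁` — inner — or `> w₂` — outer); otherwise it is **rough**, its missing segment leaves `D`, and its
**foot** (first exit point, `…WindowRectWhisker.exists_foot`) is a point of `∂D` within `δ` of its site, with
real boundary parameter `u = g(foot)` within `κ` of the chart point of the site, with `H(foot) = e^{iθ(u)}`,
`θ(u) = π + 2 arctan u`, and off the segments of `E`. [folklore]
-/

noncomputable section

open scoped Classical Topology Real
open Filter Set Metric Complex
open Literature.Probability.LatticeModels Literature.Probability.RandomPlanarGeometry
open Literature.Probability.LatticeModels.DiscreteRect Literature.Topology.PlaneTopology
open UpperHalfPlane (upperHalfPlaneSet)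

namespace Summit.CriticalPhenomena.SAWScalingLimit.Theorems.IsingBoundaryRatio

namespace WindowRect

/-- Integrality: `δ n = t` with `0 ≤ t ≤ δ`, `δ > 0`, `n ∈ ℤ` forces `n ∈ {0, 1}`. [folklore] -/
theorem int_cases_of_mul_eq {δ t : ℝ} (hδ : 0 < δ) (ht0 : 0 ≤ t) (ht1 : t ≤ δ) {n : ℤ} (h : δ * (n : ℝ) = t) :
    n = 0 ∨ n = 1 := by
  have h1 : (0 : ℝ) ≤ n := by nlinarith
  have h2 : (n : ℝ) ≤ 1 := by nlinarith
  have h1' : (0 : ℤ) ≤ n := by exact_mod_cast h1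
  have h2' : n ≤ 1 := by exact_mod_cast h2
  omega

/-- A lattice point on a lattice edge is one of its ends. [folklore] -/
theorem eq_or_eq_of_meshPoint_mem_segment {δ : ℝ} (hδ : 0 < δ) {y v : Site 2} {j : Fin 4}
    (h : meshPoint δ y ∈ segment ℝ (meshPoint δ v) (meshPoint δ (v + dir j))) : y = v ∨ y = v + dir j := by
  obtain ⟨t, ⟨ht0, ht1⟩, hty⟩ := exists_of_mem_edge hδ h
  have hre := congrArg Complex.re hty
  have him := congrArg Complex.im hty
  simp only [meshPoint_re, meshPoint_im, framePt_re, framePt_im, zero_mul, add_zero] at hre him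
  rw [Site.eq_iff_two, Site.eq_iff_two]
  simp only [Pi.add_apply]
  rcases dir_apply_cases j with ⟨h0, h1⟩ | ⟨h0, h1⟩ | ⟨h0, h1⟩ | ⟨h0, h1⟩ <;>
    simp only [h0, h1] at hre him ⊢ <;> push_cast at hre him
  · have hy1 : y 1 = v 1 := by
      have : (δ : ℝ) * (y 1 : ℝ) = δ * (v 1 : ℝ) := by linarith
      exact_mod_cast mul_left_cancel₀ hδ.ne' this
    have hq : δ * ((y 0 - v 0 : ℤ) : ℝ) = t := by push_cast; linarith
    rcases int_cases_of_mul_eq hδ ht0 ht1 hq with hi | hi <;> omega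
  · have hy0 : y 0 = v 0 := by
      have : (δ : ℝ) * (y 0 : ℝ) = δ * (v 0 : ℝ) := by linarith
      exact_mod_cast mul_left_cancel₀ hδ.ne' this
    have hq : δ * ((y 1 - v 1 : ℤ) : ℝ) = t := by push_cast; linarith
    rcases int_cases_of_mul_eq hδ ht0 ht1 hq with hi | hi <;> omega
  · have hy1 : y 1 = v 1 := by
      have : (δ : ℝ) * (y 1 : ℝ) = δ * (v 1 : ℝ) := by linarith
      exact_mod_cast mul_left_cancel₀ hδ.ne' this
    have hq : δ * ((v 0 - y 0 : ℤ) : ℝ) = t := by push_cast; linarith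
    rcases int_cases_of_mul_eq hδ ht0 ht1 hq with hi | hi <;> omega
  · have hy0 : y 0 = v 0 := by
      have : (δ : ℝ) * (y 0 : ℝ) = δ * (v 0 : ℝ) := by linarith
      exact_mod_cast mul_left_cancel₀ hδ.ne' this
    have hq : δ * ((v 1 - y 1 : ℤ) : ℝ) = t := by push_cast; linarith
    rcases int_cases_of_mul_eq hδ ht0 ht1 hq with hi | hi <;> omega

namespace WSetting

variable (X : WSetting)

/-! ### The boundary cycle -/

/-- **The base dart**: an outer rim dart of `E` (`exists_O_dart`). [folklore] -/
def d₀ : Site 2 × Fin 4 := Classical.choose X.exists_O_dart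

/-- Specification of the base dart. [folklore] -/
theorem d₀_spec : IsExtDart X.E X.d₀ ∧ (discreteDomainGraph X.D.carrier X.δ).Adj X.d₀.1 (X.d₀.1 + dir X.d₀.2) ∧
    X.w₂ < X.rad (X.d₀.1 + dir X.d₀.2) := Classical.choose_spec X.exists_O_dart

/-- **The period** of the orbit of the base dart. [folklore] -/
def N : ℕ := Classical.choose (exists_period X.d₀_spec.1)

/-- Specification of the period. [folklore] -/
theorem N_spec : 0 < X.N ∧ (succ X.E)^[X.N] X.d₀ = X.d₀ ∧
    ∀ i j, i < X.N → j < X.N → (succ X.E)^[i] X.d₀ = (succ X.E)^[j] X.d₀ → i = j :=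
  Classical.choose_spec (exists_period X.d₀_spec.1)

/-- The `i`-th dart of the boundary cycle. [folklore] -/
def dart (i : ℕ) : Site 2 × Fin 4 := (succ X.E)^[i] X.d₀

/-- The site of the `i`-th dart. [folklore] -/
def site (i : ℕ) : Site 2 := (X.dart i).1

/-- The far end of the missing edge of the `i`-th dart. [folklore] -/
def farSite (i : ℕ) : Site 2 := X.site i + dir (X.dart i).2

/-- `dart` unfolded. [folklore] -/
theorem dart_def (i : ℕ) : X.dart i = (succ X.E)^[i] X.d₀ := rfl
/-- `site` unfolded. [folklore] -/
theorem site_def (i : ℕ) : X.site i = (X.dart i).1 := rfl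
/-- `farSite` unfolded. [folklore] -/
theorem farSite_def (i : ℕ) : X.farSite i = X.site i + dir (X.dart i).2 := rfl

/-- `dart (i + 1) = succ (dart i)`. [folklore] -/
theorem dart_succ (i : ℕ) : X.dart (i + 1) = succ X.E (X.dart i) := by
  rw [dart_def, dart_def, Function.iterate_succ_apply']

/-- `dart (i + j) = succ^[j] (dart i)`. [folklore] -/
theorem dart_add (i j : ℕ) : X.dart (i + j) = (succ X.E)^[j] (X.dart i) := by
  rw [dart_def, dart_def, add_comm, Function.iterate_add_apply]

/-- Periodicity. [folklore] -/
theorem dart_add_N (i : ℕ) : X.dart (i + X.N) = X.dart i := by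
  rw [dart_def, dart_def, Function.iterate_add_apply, X.N_spec.2.1]

/-- Periodicity, `mod` form. [folklore] -/
theorem dart_mod (i : ℕ) : X.dart (i % X.N) = X.dart i := by
  rw [dart_def, dart_def]; exact iterate_mod_eq X.N_spec.2.1 i

/-- Every dart of the cycle is an external dart of `E`. [folklore] -/
theorem dart_ext (i : ℕ) : IsExtDart X.E (X.dart i) := X.d₀_spec.1.iterate i

/-- **Injectivity within a period from any start.** [folklore] -/
theorem dart_inj {i a b : ℕ} (ha : a < X.N) (hb : b < X.N) (h : X.dart (i + a) = X.dart (i + b)) : a = b := by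
  have hN := X.N_spec.1
  have h' : X.dart ((i + a) % X.N) = X.dart ((i + b) % X.N) := by rw [dart_mod, dart_mod, h]
  have hmod : (i + a) % X.N = (i + b) % X.N := X.N_spec.2.2 _ _ (Nat.mod_lt _ hN) (Nat.mod_lt _ hN) h'
  have hab : a ≡ b [MOD X.N] := Nat.ModEq.add_left_cancel' i hmod
  rwa [Nat.ModEq, Nat.mod_eq_of_lt ha, Nat.mod_eq_of_lt hb] at hab

/-- Injectivity of the iterates of `succ` from any dart of the cycle, in the form used by the feet theorem.
[folklore] -/
theorem iterate_inj (i : ℕ) : ∀ a b, a < X.N → b < X.N → (succ X.E)^[a] (X.dart i) = (succ X.E)^[b] (X.dart i) → a = b :=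
  fun a b ha hb h => X.dart_inj (i := i) ha hb (by rw [dart_add, dart_add]; exact h)

/-- **The cycle covers all external darts.** [folklore] -/
theorem cover {d : Site 2 × Fin 4} (hd : IsExtDart X.E d) : ∃ i < X.N, X.dart i = d :=
  exists_iterate_succ_eq_of_escape X.E_subset_zd X.E_connected X.E_escape X.d₀_spec.1 X.N_spec.1 X.N_spec.2.1
    X.N_spec.2.2 hd

/-! ### Sites of the cycle -/

/-- The site of a dart is in `S`. [folklore] -/
theorem site_mem_S (i : ℕ) : X.site i ∈ X.S := X.mem_S_of_isExtDart (X.dart_ext i)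

/-- The site of a dart is a vertex of `Ω_δ`. [folklore] -/
theorem site_mem_meshDomain (i : ℕ) : X.site i ∈ meshDomain X.D.carrier X.δ := X.mem_meshDomain_of_mem_S (X.site_mem_S i)

/-- The mesh point of the site of a dart is in `D`. [folklore] -/
theorem site_mem_D (i : ℕ) : meshPoint X.δ (X.site i) ∈ X.D.carrier := X.meshPoint_mem (X.site_mem_meshDomain i)

/-- The site of a dart is a vertex of `E`. [folklore] -/
theorem site_mem_verts (i : ℕ) : X.site i ∈ verts X.E := (X.dart_ext i).1

/-- The chart radius of the site of a dart is in `[w₁, w₂]`. [folklore] -/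
theorem site_rad (i : ℕ) : X.w₁ ≤ X.rad (X.site i) ∧ X.rad (X.site i) ≤ X.w₂ := (X.S_subset_Wset (X.site_mem_S i)).2

/-- The missing edge of a dart is not in `E`. [folklore] -/
theorem edge_not_mem (i : ℕ) : s(X.site i, X.farSite i) ∉ X.E := (X.dart_ext i).2

/-- **Consecutive dart sites are within `2δ`.** [folklore] -/
theorem dist_site_succ (i : ℕ) : dist (meshPoint X.δ (X.site i)) (meshPoint X.δ (X.site (i + 1))) ≤ 2 * X.δ := by
  rw [site_def, site_def, dart_succ]
  set x := (X.dart i).1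
  set k := (X.dart i).2
  have hx : X.dart i = (x, k) := rfl
  rw [hx]
  have hδ := X.hδ
  rcases succ_spec X.E x k with ⟨-, h⟩ | ⟨-, -, h⟩ | ⟨-, -, -, h⟩ | ⟨-, -, -, h⟩ <;> rw [h]
  · simp; linarith
  · rw [dist_meshPoint_add_dir hδ]; linarith
  · calc dist (meshPoint X.δ x) (meshPoint X.δ (x + dir (k + 1) + dir k))
        ≤ dist (meshPoint X.δ x) (meshPoint X.δ (x + dir (k + 1))) +
          dist (meshPoint X.δ (x + dir (k + 1))) (meshPoint X.δ (x + dir (k + 1) + dir k)) := dist_triangle _ _ _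
      _ = 2 * X.δ := by rw [dist_meshPoint_add_dir hδ, dist_meshPoint_add_dir hδ]; ring
      _ ≤ 2 * X.δ := le_rfl
  · rw [dist_meshPoint_add_dir hδ]; linarith

/-- **Chart continuity along the cycle**: consecutive dart sites have chart points within `κ`. [folklore] -/
theorem chart_step (i : ℕ) :
    dist (X.φ.symm (meshPoint X.δ (X.site (i + 1)))) (X.φ.symm (meshPoint X.δ (X.site i))) ≤ X.κ :=
  X.osc' (X.site_mem_D i) (by rw [← rad_def]; linarith [(X.site_rad i).2, X.radii.2.2.2.2.2, X.hm]) (X.site_mem_D (i + 1))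
    (X.dist_site_succ i)

/-! ### Rim darts -/

/-- **Rim positions**: the missing edge of the dart is an edge of `Ω_δ`. [folklore] -/
def rim : Set ℕ := {i | (discreteDomainGraph X.D.carrier X.δ).Adj (X.site i) (X.farSite i)}

/-- Membership in `rim`, unfolded. [folklore] -/
theorem mem_rim_iff {i : ℕ} : i ∈ X.rim ↔ (discreteDomainGraph X.D.carrier X.δ).Adj (X.site i) (X.farSite i) := Iff.rfl

/-- **The far end of a rim dart**: a vertex of `Ω_δ`, not a vertex of `E`, off the window, with chart radius
within `κ` of that of the site. [folklore] -/
theorem rim_facts {i : ℕ} (hi : i ∈ X.rim) : X.farSite i ∈ meshDomain X.D.carrier X.δ ∧ X.farSite i ∉ verts X.E ∧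
    (X.rad (X.farSite i) < X.w₁ ∨ X.w₂ < X.rad (X.farSite i)) ∧ |X.rad (X.farSite i) - X.rad (X.site i)| ≤ X.κ := by
  have hadj := X.mem_rim_iff.1 hi
  obtain ⟨hmesh, -, hfar⟩ := discreteDomainGraph_adj_iff.1 hadj
  have hnv : X.farSite i ∉ verts X.E := fun h => X.edge_not_mem i (X.E_induced (X.site_mem_verts i) h hadj)
  have hrad : |X.rad (X.farSite i) - X.rad (X.site i)| ≤ X.κ :=
    X.abs_rad_sub_rad_le (X.site_mem_D i) (X.meshPoint_mem hfar) (meshGraph_adj_iff.1 hmesh).1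
      (by linarith [(X.site_rad i).2, X.radii.2.2.2.2.2, X.hm, X.hκ])
  refine ⟨hfar, hnv, ?_, hrad⟩
  by_contra hcon
  push Not at hcon
  have hW : X.farSite i ∈ X.Wset := ⟨hfar, hcon.1, hcon.2⟩
  have hS := X.mem_S_of_adj (X.site_mem_S i) hadj hW
  exact hnv (X.mem_verts_E_of_mem_S hS (X.site_mem_S i) hadj.symm)

/-- **Inner rim positions** (far end of chart radius `< w₁`). [folklore] -/
def inner : Set ℕ := {i | i ∈ X.rim ∧ X.rad (X.farSite i) < X.w₁}

/-- **Outer rim positions** (far end of chart radius `> w₂`). [folklore] -/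
def outer : Set ℕ := {i | i ∈ X.rim ∧ X.w₂ < X.rad (X.farSite i)}

/-- Membership in `inner`, unfolded. [folklore] -/
theorem mem_inner_iff {i : ℕ} : i ∈ X.inner ↔ i ∈ X.rim ∧ X.rad (X.farSite i) < X.w₁ := Iff.rfl
/-- Membership in `outer`, unfolded. [folklore] -/
theorem mem_outer_iff {i : ℕ} : i ∈ X.outer ↔ i ∈ X.rim ∧ X.w₂ < X.rad (X.farSite i) := Iff.rfl
/-- A rim position is inner or outer. [folklore] -/
theorem rim_cases {i : ℕ} (hi : i ∈ X.rim) : i ∈ X.inner ∨ i ∈ X.outer :=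
  ((X.rim_facts hi).2.2.1).imp (fun h => ⟨hi, h⟩) fun h => ⟨hi, h⟩

/-- The site of an inner rim dart has chart radius `< w₁ + κ`. [folklore] -/
theorem rad_lt_of_inner {i : ℕ} (hi : i ∈ X.inner) : X.rad (X.site i) < X.w₁ + X.κ := by
  have h := abs_le.1 (X.rim_facts hi.1).2.2.2; linarith [hi.2]

/-- The site of an outer rim dart has chart radius `> w₂ - κ`. [folklore] -/
theorem lt_rad_of_outer {i : ℕ} (hi : i ∈ X.outer) : X.w₂ - X.κ < X.rad (X.site i) := by
  have h := abs_le.1 (X.rim_facts hi.1).2.2.2; linarith [hi.2]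

/-- Inner and outer are disjoint. [folklore] -/
theorem not_outer_of_inner {i : ℕ} (hi : i ∈ X.inner) : i ∉ X.outer := fun h => by
  have := X.radii; have := X.hm; linarith [hi.2, h.2]

/-- The base position `0` is outer. [folklore] -/
theorem zero_mem_outer : 0 ∈ X.outer := ⟨X.d₀_spec.2.1, X.d₀_spec.2.2⟩

/-- `rim`, `inner`, `outer` are `N`-periodic. [folklore] -/
theorem mem_rim_add_N {i : ℕ} : i + X.N ∈ X.rim ↔ i ∈ X.rim := by
  simp only [mem_rim_iff, site_def, farSite_def, dart_add_N]
/-- `inner` is `N`-periodic. [folklore] -/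
theorem mem_inner_add_N {i : ℕ} : i + X.N ∈ X.inner ↔ i ∈ X.inner := by
  simp only [mem_inner_iff, mem_rim_add_N, farSite_def, site_def, dart_add_N]
/-- `outer` is `N`-periodic. [folklore] -/
theorem mem_outer_add_N {i : ℕ} : i + X.N ∈ X.outer ↔ i ∈ X.outer := by
  simp only [mem_outer_iff, mem_rim_add_N, farSite_def, site_def, dart_add_N]

/-! ### Rough darts and their feet -/

/-- **A rough dart's missing segment leaves `D`.** [folklore] -/
theorem exists_not_mem_of_not_rim {i : ℕ} (hi : i ∉ X.rim) :
    ∃ z ∈ segment ℝ (meshPoint X.δ (X.site i)) (meshPoint X.δ (X.farSite i)), z ∉ X.D.carrier := by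
  by_contra hcon
  push Not at hcon
  apply hi
  rw [mem_rim_iff]
  have hzd : (zdGraph 2).Adj (X.site i) (X.farSite i) := by rw [farSite_def]; exact zdGraph_adj_add_dir _ _
  have hmesh : (meshGraph X.D.carrier X.δ).Adj (X.site i) (X.farSite i) :=
    meshGraph_adj_iff.2 ⟨hzd, fun z hz => subset_closure (hcon z hz)⟩
  have hfarD : meshPoint X.δ (X.farSite i) ∈ X.D.carrier := hcon _ (right_mem_segment _ _ _)
  have hfar : X.farSite i ∈ meshDomain X.D.carrier X.δ :=
    (forall_mem_meshDomain_of_walk (SimpleGraph.Walk.cons hmesh SimpleGraph.Walk.nil) (X.site_mem_meshDomain i)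
      (by intro s hs; simp at hs; rcases hs with rfl | rfl; exacts [X.site_mem_D i, hfarD])) _ (by simp)
  exact discreteDomainGraph_adj_iff.2 ⟨hmesh, X.site_mem_meshDomain i, hfar⟩

/-- The foot parameter of a rough dart (and `δ` at rim darts, unused). [folklore] -/
def footS (i : ℕ) : ℝ :=
  if hi : i ∉ X.rim then Classical.choose (exists_foot X.hδ X.D.isOpen (k := (X.dart i).2) (X.site_mem_D i)
    (X.exists_not_mem_of_not_rim hi)) else X.δ

/-- **The foot** of the `i`-th dart: the first exit point of its missing segment from `D`. [folklore] -/
def foot (i : ℕ) : ℂ := framePt X.δ (X.dart i) (X.footS i) 0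

/-- **The boundary parameter** of the foot: `u = re g(foot)`. [folklore] -/
def u (i : ℕ) : ℝ := (X.g (X.foot i)).re

/-- Specification of the foot of a rough dart. [folklore] -/
theorem foot_spec {i : ℕ} (hi : i ∉ X.rim) : X.footS i ∈ Ioc 0 X.δ ∧ X.foot i ∈ frontier X.D.carrier ∧
    X.foot i ∉ X.D.carrier ∧ ∀ s' ∈ Ico 0 (X.footS i), framePt X.δ (X.dart i) s' 0 ∈ X.D.carrier := by
  have h := Classical.choose_spec (exists_foot X.hδ X.D.isOpen (k := (X.dart i).2) (X.site_mem_D i)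
    (X.exists_not_mem_of_not_rim hi))
  have e : X.footS i = Classical.choose (exists_foot X.hδ X.D.isOpen (k := (X.dart i).2) (X.site_mem_D i)
    (X.exists_not_mem_of_not_rim hi)) := by rw [footS, dif_pos hi]
  rw [foot, e]
  exact ⟨h.1, h.2.1, h.2.2.1, h.2.2.2⟩

/-- The foot lies on the closed missing segment. [folklore] -/
theorem foot_mem_segment {i : ℕ} (hi : i ∉ X.rim) :
    X.foot i ∈ segment ℝ (meshPoint X.δ (X.site i)) (meshPoint X.δ (X.farSite i)) := by
  rw [foot, farSite_def, site_def]
  have h := (X.foot_spec hi).1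
  have := framePt_axis_mem_segment' X.hδ (X.dart i).1 (X.dart i).2 (t := X.footS i) ⟨h.1.le, h.2⟩
  simpa using this

/-- The foot is within `δ` of the mesh point of the site. [folklore] -/
theorem dist_foot_le {i : ℕ} (hi : i ∉ X.rim) : dist (meshPoint X.δ (X.site i)) (X.foot i) ≤ X.δ := by
  have hzd : (zdGraph 2).Adj (X.site i) (X.farSite i) := by rw [farSite_def]; exact zdGraph_adj_add_dir _ _
  have hb := (convex_closedBall (meshPoint X.δ (X.site i)) X.δ).segment_subset (mem_closedBall_self X.hδ.le)
    (by rw [mem_closedBall, dist_comm, X.dist_meshPoint_adj hzd]) (X.foot_mem_segment hi)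
  rw [mem_closedBall, dist_comm] at hb
  exact hb

/-- The foot is in `closure D`, not `b`. [folklore] -/
theorem foot_closure {i : ℕ} (hi : i ∉ X.rim) : X.foot i ∈ closure X.D.carrier ∧ X.foot i ≠ X.D.pt 1 := by
  refine ⟨frontier_subset_closure (X.foot_spec hi).2.1, fun h => ?_⟩
  have h1 := X.far (X.site_mem_D i) (by rw [← rad_def]; linarith [(X.site_rad i).2, X.radii.2.2.2.2.2, X.hm])
  rw [← h] at h1
  linarith [X.dist_foot_le hi, X.hδd, X.hδ]

/-- **`g(foot) = u` is real.** [folklore] -/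
theorem g_foot {i : ℕ} (hi : i ∉ X.rim) : X.g (X.foot i) = X.u i := by
  apply Complex.ext
  · simp [u]
  · rw [Complex.ofReal_im]; exact X.hg_real _ (X.foot_spec hi).2.1 (X.foot_closure hi).2

/-- **The foot parameter is within `κ` of the chart point of the site.** [folklore] -/
theorem dist_u_chart {i : ℕ} (hi : i ∉ X.rim) : dist ((X.u i : ℂ)) (X.φ.symm (meshPoint X.δ (X.site i))) ≤ X.κ := by
  rw [← X.g_foot hi]
  exact X.osc (X.site_mem_D i) (by rw [← rad_def]; linarith [(X.site_rad i).2, X.radii.2.2.2.2.2, X.hm])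
    (X.foot_closure hi).1 (by linarith [X.dist_foot_le hi, X.hδ])

/-- Consequences: `| |u| - rad(site) | ≤ κ` and the chart point of the site has `|im| ≤ κ`. [folklore] -/
theorem u_facts {i : ℕ} (hi : i ∉ X.rim) : |(|X.u i|) - X.rad (X.site i)| ≤ X.κ ∧
    |(X.φ.symm (meshPoint X.δ (X.site i))).im| ≤ X.κ ∧ |X.u i - (X.φ.symm (meshPoint X.δ (X.site i))).re| ≤ X.κ := by
  have h := X.dist_u_chart hi
  rw [Complex.dist_eq] at h
  refine ⟨?_, ?_, ?_⟩
  · have h1 := abs_norm_sub_norm_le ((X.u i : ℂ)) (X.φ.symm (meshPoint X.δ (X.site i)))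
    rw [Complex.norm_real, Real.norm_eq_abs] at h1
    rw [rad_def]; exact h1.trans h
  · have h1 := (abs_im_le_norm _).trans h
    rw [Complex.sub_im, Complex.ofReal_im, zero_sub, abs_neg] at h1
    exact h1
  · have h1 := (abs_re_le_norm _).trans h
    rw [Complex.sub_re, Complex.ofReal_re] at h1
    exact h1

/-- `|u| ≤ r₂ + m`. [folklore] -/
theorem abs_u_le {i : ℕ} (hi : i ∉ X.rim) : |X.u i| ≤ X.r₂ + X.m := by
  have h := abs_le.1 (X.u_facts hi).1
  linarith [(X.site_rad i).2, X.radii.2.2.2.2.2, X.hm, X.κ_le.1]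

/-- **The unit-disc chart at the foot**: `H(foot) = e^{i θ(u)}`, `θ(u) = π + 2 arctan u`. [folklore] -/
theorem H_foot {i : ℕ} (hi : i ∉ X.rim) : X.H (X.foot i) = circleMap 0 1 (π + 2 * Real.arctan (X.u i)) := by
  rw [X.hH_fr _ (X.foot_spec hi).2.1 (X.foot_closure hi).2, circleMap_zero]
  simp [u]

/-- **The foot is off the segments of `E`.** [folklore] -/
theorem foot_not_mem_segment {i : ℕ} (hi : i ∉ X.rim) :
    ∀ v w : Site 2, s(v, w) ∈ X.E → X.foot i ∉ segment ℝ (meshPoint X.δ v) (meshPoint X.δ w) := by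
  intro v w hvw hmem
  obtain ⟨⟨hS0, hSδ⟩, -, hfD, -⟩ := X.foot_spec hi
  have hzd : (zdGraph 2).Adj v w := by
    have := X.E_subset_zd _ hvw; rwa [SimpleGraph.mem_edgeSet] at this
  obtain ⟨j, rfl⟩ := exists_eq_add_dir_of_adj hzd
  rcases hSδ.lt_or_eq with hlt | heq
  · -- an interior axis point: the edge is the missing edge
    rw [foot, show X.dart i = ((X.dart i).1, (X.dart i).2) from rfl] at hmem
    have h := edge_eq_of_axisPt_mem_segment X.hδ ⟨hS0, hlt⟩ (zdGraph_adj_add_dir v j) hmem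
    have : s(v, v + dir j) = s(X.site i, X.farSite i) := by rw [h]; rfl
    exact X.edge_not_mem i (this ▸ hvw)
  · -- the far end, a lattice point off `D`, on an edge of `E`: it would be a vertex of `E`
    have hfar : X.foot i = meshPoint X.δ (X.farSite i) := by
      rw [foot, heq, farSite_def, site_def]
      apply Complex.ext <;> simp [framePt, meshPoint] <;> ring
    rw [hfar] at hmem hfD
    rcases eq_or_eq_of_meshPoint_mem_segment X.hδ hmem with h | h
    · exact hfD (h ▸ X.meshPoint_mem_of_mem_verts (mem_verts_of_mem_left hvw))
    · exact hfD (h ▸ X.meshPoint_mem_of_mem_verts (DiscreteRect.mem_verts_of_mem hvw))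

/-- The segments of `E` lie in `closure D`. [folklore] -/
theorem segment_subset_closure {v w : Site 2} (h : s(v, w) ∈ X.E) :
    segment ℝ (meshPoint X.δ v) (meshPoint X.δ w) ⊆ closure X.D.carrier := by
  have := X.E_subset_edgeSet _ h
  rw [SimpleGraph.mem_edgeSet] at this
  exact (meshGraph_adj_iff.1 (discreteDomainGraph_adj_iff.1 this).1).2

end WSetting

end WindowRect

/-- **The base position of the boundary cycle is an outer rim dart**, closed form (registered sub-goal of
stmt-CriticalPhenomena-10650). [folklore] -/
theorem windowRect_zero_mem_outer : ∀ (X : WindowRect.WSetting), 0 ∈ X.outer :=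
  fun X => X.zero_mem_outer

end Summit.CriticalPhenomena.SAWScalingLimit.Theorems.IsingBoundaryRatio

end
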